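/-
Copyright (c) 2026 the pub-hodgecm-mathlib formalisation cell (harness21).  Prover seat hodgecm-mathlib-LA3-p01 (g0), «GO 500» half A line L3
(socket `stub_FROB`, road ROOF → `stub_ROOF0`), organ #1 «THE COVER LEG OF A ROOF AT AN ITERATED BASE CHANGE»; 2026-09-02.
-/
import Literature.AlgebraicGeometry.AbelianSchemes.SerreTwistBaseChange
import Literature.AlgebraicGeometry.AbelianSchemes.SerreTensorBaseChange
import Literature.AlgebraicGeometry.AbelianSchemes.LevelStructureOfIsogeny
import Literature.AlgebraicGeometry.AbelianSchemes.SymplecticLiftOfIsogenyTower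
import Literature.AlgebraicGeometry.GroupSchemes.GeneralLinearGroupSchemeBaseChange
import Literature.AlgebraicGeometry.Limits.SurjectiveSpread
import HarnessLib

/-!
# The ideal translation `ψ_P : 𝒜 → 𝒜 ⊗_𝒪 𝔭⁻¹` of a FAMILY read at an iterated base change `(𝒜 ×_Y Y′) ×_{Y′} Y″`: kernel `𝒜_{Y″}[𝔭]` on ALL points,
# surjective ∕ flat ∕ finite, `𝒪`-equivariant, carrying level sections and the exact twisted polarisation (the COVER LEG `c̄` of an isogeny roof)

Topic `AlgebraicGeometry/AbelianSchemes`, namespace `Literature.AlgebraicGeometry.AbelianSchemes.AbelianSchemeOver`.  THEOREMS ONLY (no definition, no named fact,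
no `instance`, no notation, no `sorry`); ANY base schemes `Y″ → Y′ → Y`.  Cell `hodgecm-mathlib` (D-0151), F0∕P6 «MOD», «GO 500» line L3 (socket `stub_FROB` of the
D-line `Cruxes/HLiu418/Lines/F0_P6a_DatumOfInputs.lean`), road ROOF → `stub_ROOF0` (LEAD F0P6-plan (g3) L-DEAL v1 §L3; LA3-plan (g0) deal v1 02:02Z): the rows
(r2₀) «`Ker c̄ = A_{x̄″}[𝔭]` on `T`-points, `c̄` surjective», (r4₀-c) «`ι″(a) ≫ c̄ = c̄ ≫ b`», (r5₀-c) «`c̄(σ^a(x̄″)) = σ_𝒞^a(x̄″)`», (r3₀-c) «`c̄ ≫ λ_B̄ ≫ c̄^∨ = λ_{x̄″} ≫ [c]`»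
of the downstairs roof `Roof₀` (P6a Defs ED. 3 :542) for the cover leg **`c̄ := (ψ_P ×_Y Y′) ×_{Y′} Y″`** of the FAMILY translation `ψ_P : 𝒜 → 𝒞 := 𝒜 ⊗_𝒪 𝔟`
(`𝔟 ≅ 𝔭⁻¹`), read at the iterated base change `sch₀Of … x̄″ = (𝒜 ×_𝓨 𝓨_s) ×_{𝓨_s} x̄″` (and `schΩOf … y″` upstairs) — no reduction of homomorphisms is involved on this leg.
`--supports stmt-HodgeConjecture-24832`, count-neutral.  HONEST LABEL: HC_CM is proved only modulo the cell's 2 remaining named inputs (hLiu418 24832, h413 24833) until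
rung 0 closes; this file discharges none of them.

## Mathematics

([Conrad2004GrossZagier] §7 Thm. 7.5: Serre's construction and its structure maps commute with base change; [GortzWedhorn2020] (4.15), Def. 4.45 (2): kernels and
`T`-valued points under base change; [MumfordFogartyKirwan1994] Ch. 7 §2 Def. 7.2: the moduli data pull back.)  §1 is generic: for a homomorphism `φ : A → B` of abelian
`S`-schemes with an `𝒪`-action `ι` on `A`, an IDEAL-KERNEL LAW «`t ≫ φ = 1 ↔ ∀ a ∈ 𝔭, t ≫ ι(a) = 1` for every `S`-scheme `T` and every `t ∈ A(T)`» BASE-CHANGES to the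
same law for `φ ×_S S′` and `ι ×_S S′` over `S′` — a `T′`-point of `A ×_S S′` over `S′` is a `T′`-point of `A` over `S` (transposition along `Over.map g ⊣ Over.pullback g`,
which is multiplicative, ★ `adjunction_homEquiv_one`), and `(t ≫ φ_{S′})♭ = t♭ ≫ φ`.  Likewise surjectivity, flatness and finiteness of `φ` base-change (the square
`(φ_{S′}, A_{S′} → A; B_{S′} → B, φ)` is cartesian, ★ `Limits.isPullback_pullback_map_left`).  §2 iterates twice for `ψ_P` (★ `serreTranslate`, kernel `A[𝔭]` on points
★ `comp_serreTranslate_eq_one_iff_forall_mem`, fppf ★ `surjective∕flat∕isFinite_serreTranslate_left`, equivariant ★ `i_comp_serreTranslate`); §3 reads the level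
sections (★ `map_fibreHom_restrictPt`, ★ `LevelStructure.section_of_σ_comp`, ★ `LevelStructure.baseChange_σ_serreTwist`) and the exact twisted polarisation (★
`IsExactTwistPol`, ★ `DualPair.baseChangeHom_similitude_base` twice) at a point of the first base change; §4 is the bridge `c̄ ≫ β₂ = ψ_P(A_{Y″})` to the Serre tensor OF
the iterated base change (★ `serreTranslateBC_comp_baseChangeIso` twice), the currency of ★ KER-EQ `exists_iso_serreTranslate_comp_eq_of_comp_eq_one_iff_forall_mem`.

## Contents
* §1 `comp_baseChangeHom_eq_one_iff_homEquiv_symm`, **`idealKernelLaw_baseChangeHom`**, `surjective_baseChangeHom_left`, `flat_baseChangeHom_left`,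
  `isFinite_baseChangeHom_left`, `i_baseChange_comp_baseChangeHom`.
* §2 (`c̄ := baseChangeHom (baseChangeHom ψ_P g) s`) `isMonHom_coverLeg`, **`comp_coverLeg_eq_one_iff_forall_mem`**, `surjective_coverLeg_left`, `flat_coverLeg_left`,
  `isFinite_coverLeg_left`, **`i_comp_coverLeg`**.
* §3 (at a field point `x` of `Y′`) **`map_coverLeg_restrictPt_section`**, **`coverLeg_comp_lam_comp_dualIsogenyOver_of_isExactTwistPol`**.
* §4 **`coverLeg_comp_baseChangeIso₂_hom`**, `isMonHom_baseChangeIso₂`.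

## References
* [Conrad2004GrossZagier] B. Conrad, *Gross–Zagier revisited*, MSRI Publ. 49 (2004), §7 (Thm. 7.5).
* [GortzWedhorn2020] U. Görtz, T. Wedhorn, *Algebraic Geometry I*, 2nd ed. (2020), (4.15) (p. 116), Def. 4.45 (2) (p. 117), Section (4.7) (pp. 107–108).
* [MumfordFogartyKirwan1994] D. Mumford, J. Fogarty, F. Kirwan, *GIT*, 3rd ed. (1994), Ch. 6 §1 Cor. 6.8 (p. 118), Ch. 7 §2 Def. 7.2 (p. 129).
* [RapoportSmithlingZhang2020Diagonal] M. Rapoport, B. Smithling, W. Zhang (2020), §3.2, §4.3 (4.23) (p. 21).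
* [EGAIV2] A. Grothendieck, J. Dieudonné, EGA IV₂ (1965), Prop. 2.3.4 (base change squares).
-/

set_option autoImplicit false

noncomputable section

universe u

open CategoryTheory CategoryTheory.Limits AlgebraicGeometry MonoidalCategory CartesianMonoidalCategory
open scoped MonObj
open Literature.AlgebraicGeometry.GroupSchemes (adjunction_homEquiv_symm_one)
open Literature.AlgebraicGeometry.Limits (isPullback_pullback_map_left)
open Literature.AlgebraicGeometry.Motives (AlgPoints)

namespace Literature.AlgebraicGeometry.AbelianSchemes

namespace AbelianSchemeOver

set_option backward.isDefEq.respectTransparency false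

/-! ## §1 Ideal-kernel laws, surjectivity, flatness, finiteness and equivariance BASE-CHANGE (generic) -/

section Generic

variable {S S' : Scheme.{u}} (g : S' ⟶ S) {A B : AbelianSchemeOver S} {O : Type*} [CommRing O]

/-- **A `T′`-point of `A ×_S S′` is killed by `φ ×_S S′` iff its transpose is killed by `φ`**: `t ≫ φ_{S′} = 1 ↔ t♭ ≫ φ = 1`, `t♭` the transpose of `t` along
`Over.map g ⊣ Over.pullback g` (naturality of the transposition and ★ `adjunction_homEquiv_symm_one`). [cite: GortzWedhorn2020, (4.15) (p. 116) and Definition 4.45 (2) (p. 117)] -/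
theorem comp_baseChangeHom_eq_one_iff_homEquiv_symm (φ : A.X ⟶ B.X) {T : Over S'} (t : T ⟶ (A.baseChange g).X) :
    t ≫ baseChangeHom φ g = 1 ↔ ((Over.mapPullbackAdj g).homEquiv T A.X).symm t ≫ φ = 1 := by
  have key : ((Over.mapPullbackAdj g).homEquiv T B.X).symm (t ≫ baseChangeHom φ g) =
      ((Over.mapPullbackAdj g).homEquiv T A.X).symm t ≫ φ :=
    Adjunction.homEquiv_naturality_right_symm (Over.mapPullbackAdj g) t φ
  constructor
  · intro h
    rw [← key, h]
    exact adjunction_homEquiv_symm_one (Over.mapPullbackAdj g)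
  · intro h
    apply ((Over.mapPullbackAdj g).homEquiv T B.X).symm.injective
    rw [key, h]
    exact (adjunction_homEquiv_symm_one (Over.mapPullbackAdj g)).symm

/-- **IDEAL-KERNEL LAWS BASE-CHANGE.**  If `Ker φ = A[𝔭]` on ALL `T`-points over `S` (`t ≫ φ = 1 ↔ ∀ a ∈ 𝔭, t ≫ ι(a) = 1`) then `Ker (φ ×_S S′) = A_{S′}[𝔭]` on all
`T′`-points over `S′` for the base-changed action `ι ×_S S′` (★ `RingAction.baseChange`). [cite: GortzWedhorn2020, (4.15) (p. 116) and Definition 4.45 (2) (p. 117)]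
[cite: Conrad2004GrossZagier, §7 (Thm. 7.5)] -/
theorem idealKernelLaw_baseChangeHom (act : A.RingAction O) (φ : A.X ⟶ B.X) (𝔭 : Set O)
    (hφ : ∀ ⦃T : Over S⦄ (t : T ⟶ A.X), t ≫ φ = 1 ↔ ∀ a ∈ 𝔭, t ≫ act.i a = 1)
    ⦃T : Over S'⦄ (t : T ⟶ (A.baseChange g).X) :
    t ≫ baseChangeHom φ g = 1 ↔ ∀ a ∈ 𝔭, t ≫ (act.baseChange g).i a = 1 := by
  rw [comp_baseChangeHom_eq_one_iff_homEquiv_symm g φ t, hφ]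
  refine forall₂_congr fun a _ => ?_
  rw [RingAction.baseChange_i]
  exact (comp_baseChangeHom_eq_one_iff_homEquiv_symm g (act.i a) t).symm

/-- **Surjectivity base-changes**: `φ` surjective ⟹ `φ ×_S S′` surjective (the square `(φ_{S′}, pr, pr, φ)` is cartesian, ★ `Limits.isPullback_pullback_map_left`).
[cite: EGAIV2, Prop. 2.3.4] [cite: GortzWedhorn2020, Section (4.7) (pp. 107–108)] -/
theorem surjective_baseChangeHom_left (φ : A.X ⟶ B.X) [Surjective φ.left] : Surjective (baseChangeHom φ g).left :=
  MorphismProperty.of_isPullback (P := @Surjective) (isPullback_pullback_map_left g φ).flip inferInstance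

/-- **Flatness base-changes**: `φ` flat ⟹ `φ ×_S S′` flat. [cite: EGAIV2, Prop. 2.3.4] [cite: GortzWedhorn2020, Section (4.7) (pp. 107–108)] -/
theorem flat_baseChangeHom_left (φ : A.X ⟶ B.X) [Flat φ.left] : Flat (baseChangeHom φ g).left :=
  MorphismProperty.of_isPullback (P := @Flat) (isPullback_pullback_map_left g φ).flip inferInstance

/-- **Finiteness base-changes**: `φ` finite ⟹ `φ ×_S S′` finite. [cite: EGAIV2, Prop. 2.3.4] [cite: GortzWedhorn2020, Section (4.7) (pp. 107–108)] -/
theorem isFinite_baseChangeHom_left (φ : A.X ⟶ B.X) [IsFinite φ.left] : IsFinite (baseChangeHom φ g).left :=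
  MorphismProperty.of_isPullback (P := @IsFinite) (isPullback_pullback_map_left g φ).flip inferInstance

/-- **Equivariance base-changes**: `ι_A(a) ≫ φ = φ ≫ ι_B(a)` ⟹ `(ι_A ×_S S′)(a) ≫ φ_{S′} = φ_{S′} ≫ (ι_B ×_S S′)(a)` (functoriality of `×_S S′`).
[cite: Kottwitz1992, §5 (p. 390)] [cite: GortzWedhorn2020, Section (4.7) (pp. 107–108)] -/
theorem i_baseChange_comp_baseChangeHom (actA : A.RingAction O) (actB : B.RingAction O) (φ : A.X ⟶ B.X) (a : O)
    (h : actA.i a ≫ φ = φ ≫ actB.i a) :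
    (actA.baseChange g).i a ≫ baseChangeHom φ g = baseChangeHom φ g ≫ (actB.baseChange g).i a := by
  rw [RingAction.baseChange_i, RingAction.baseChange_i]
  change (Over.pullback g).map (actA.i a) ≫ (Over.pullback g).map φ = (Over.pullback g).map φ ≫ (Over.pullback g).map (actB.i a)
  rw [← Functor.map_comp, h, Functor.map_comp]

end Generic

/-! ## §2 The cover leg `c̄ := (ψ_P ×_Y Y′) ×_{Y′} Y″` of the family translation `ψ_P : 𝒜 → 𝒜 ⊗_𝒪 𝔟` -/

section CoverLeg

variable {Y Y' Y'' : Scheme.{u}} (g : Y' ⟶ Y) (s : Y'' ⟶ Y') {A : AbelianSchemeOver Y} {O : Type*} [CommRing O] (act : A.RingAction O)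
  [IsCommMonObj A.X] {m : ℕ} (E' : Matrix (Fin m) (Fin m) O) (hE' : E' * E' = E') (P : Matrix (Fin m) (Fin 1) O) (Q : Matrix (Fin 1) (Fin m) O) {N : ℕ}

/-- `c̄ = (ψ_P ×_Y Y′) ×_{Y′} Y″` is a homomorphism of `Y″`-group schemes. [cite: Conrad2004GrossZagier, §7 (Thm. 7.5)] -/
theorem isMonHom_coverLeg : IsMonHom (baseChangeHom (baseChangeHom (serreTranslate act E' hE' P) g) s) := by
  haveI := isMonHom_serreTranslate act E' hE' P
  haveI := isMonHom_baseChangeHom (serreTranslate act E' hE' P) g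
  exact isMonHom_baseChangeHom _ s

/-- **(r2₀) THE KERNEL OF THE COVER LEG IS THE `𝔭`-TORSION, SCHEME-THEORETICALLY**: for every `Y″`-scheme `T` and every `t ∈ 𝒜_{Y″}(T)`,
`t ≫ c̄ = 1 ↔ ∀ a ∈ 𝔭, t ≫ ι_{Y″}(a) = 1`, where `𝔭 = (P₁, …, P_m)` is generated by the coordinates of `P` (model case `𝔟 ≅ 𝔭⁻¹ ∋ 1 ↔ P`) and `ι_{Y″} = (ι ×_Y Y′) ×_{Y′} Y″`
(in the P6a currency: `((ρ.baseChange ι_s).baseChange x̄″.left).i a = (act₀Of 𝓜 w 𝒜 ρ a x̄″).hom.hom.hom` by `rfl`).  ★ `comp_serreTranslate_eq_one_iff_forall_mem` base-changed twice.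
[cite: Conrad2004GrossZagier, §7 (Thm. 7.5)] [cite: GortzWedhorn2020, Definition 4.45 (2) (p. 117)] [cite: RapoportSmithlingZhang2020Diagonal, §4.3 (4.23) (p. 21)] -/
theorem comp_coverLeg_eq_one_iff_forall_mem (hP : E' * P = P) {𝔭 : Ideal O} (h𝔭 : Ideal.span (Set.range fun k => P k 0) = 𝔭)
    ⦃T : Over Y''⦄ (t : T ⟶ ((A.baseChange g).baseChange s).X) :
    t ≫ baseChangeHom (baseChangeHom (serreTranslate act E' hE' P) g) s = 1 ↔ ∀ a ∈ 𝔭, t ≫ ((act.baseChange g).baseChange s).i a = 1 :=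
  idealKernelLaw_baseChangeHom s (act.baseChange g) (baseChangeHom (serreTranslate act E' hE' P) g) (𝔭 : Set O)
    (idealKernelLaw_baseChangeHom g act (serreTranslate act E' hE' P) (𝔭 : Set O)
      (fun _ t₀ => comp_serreTranslate_eq_one_iff_forall_mem act E' hE' P hP h𝔭 t₀)) t

/-- **(r2₀) THE COVER LEG IS SURJECTIVE** (quasi-inverse row `Q`: `QE′ = Q`, `QP = N`, `PQ = N·E′`, `N ≠ 0`; ★ `surjective_serreTranslate_left` base-changed twice).
[cite: Conrad2004GrossZagier, §7 (Thm. 7.5)] [cite: EGAIV2, Prop. 2.3.4] -/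
theorem surjective_coverLeg_left (hN : N ≠ 0) (hP : E' * P = P) (hQ : Q * E' = Q)
    (hQP : Q * P = Matrix.scalar (Fin 1) (N : O)) (hPQ : P * Q = Matrix.scalar (Fin m) (N : O) * E') :
    Surjective (baseChangeHom (baseChangeHom (serreTranslate act E' hE' P) g) s).left := by
  haveI := surjective_serreTranslate_left act E' hE' P Q hN hP hQ hQP hPQ
  haveI := surjective_baseChangeHom_left g (serreTranslate act E' hE' P)
  exact surjective_baseChangeHom_left s _

/-- **(r1₀-type) THE COVER LEG IS FLAT** (same hypotheses; ★ `flat_serreTranslate_left` base-changed twice). [cite: Conrad2004GrossZagier, §7 (Thm. 7.5)] [cite: EGAIV2, Prop. 2.3.4] -/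
theorem flat_coverLeg_left (hN : N ≠ 0) (hP : E' * P = P) (hQ : Q * E' = Q)
    (hQP : Q * P = Matrix.scalar (Fin 1) (N : O)) (hPQ : P * Q = Matrix.scalar (Fin m) (N : O) * E') :
    Flat (baseChangeHom (baseChangeHom (serreTranslate act E' hE' P) g) s).left := by
  haveI := flat_serreTranslate_left act E' hE' P Q hN hP hQ hQP hPQ
  haveI := flat_baseChangeHom_left g (serreTranslate act E' hE' P)
  exact flat_baseChangeHom_left s _

/-- **THE COVER LEG IS FINITE** (same hypotheses; ★ `isFinite_serreTranslate_left` base-changed twice). [cite: Conrad2004GrossZagier, §7 (Thm. 7.5)] [cite: EGAIV2, Prop. 2.3.4] -/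
theorem isFinite_coverLeg_left (hN : N ≠ 0) (hP : E' * P = P) (hQ : Q * E' = Q)
    (hQP : Q * P = Matrix.scalar (Fin 1) (N : O)) (hPQ : P * Q = Matrix.scalar (Fin m) (N : O) * E') :
    IsFinite (baseChangeHom (baseChangeHom (serreTranslate act E' hE' P) g) s).left := by
  haveI := isFinite_serreTranslate_left act E' hE' P Q hN hP hQ hQP hPQ
  haveI := isFinite_baseChangeHom_left g (serreTranslate act E' hE' P)
  exact isFinite_baseChangeHom_left s _

/-- **(r4₀-c) THE COVER LEG IS `𝒪`-EQUIVARIANT** for the iterated base changes of `ι` on `𝒜` and of the Serre action `ι_𝔟` on `𝒜 ⊗_𝒪 𝔟` (the common endomorphism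
`b := ((ι_𝔟 ×_Y Y′) ×_{Y′} Y″)(a)` of the roof's middle): ★ `i_comp_serreTranslate` base-changed twice. [cite: Kottwitz1992, §5 (p. 390)] [cite: Conrad2004GrossZagier, §7 (Thm. 7.5)] -/
theorem i_comp_coverLeg (hP : E' * P = P) (a : O) :
    ((act.baseChange g).baseChange s).i a ≫ baseChangeHom (baseChangeHom (serreTranslate act E' hE' P) g) s =
      baseChangeHom (baseChangeHom (serreTranslate act E' hE' P) g) s ≫ (((serreAction act E' hE').baseChange g).baseChange s).i a :=
  i_baseChange_comp_baseChangeHom s (act.baseChange g) ((serreAction act E' hE').baseChange g) _ a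
    (i_baseChange_comp_baseChangeHom g act (serreAction act E' hE') _ a (i_comp_serreTranslate act E' hE' P hP a))

end CoverLeg

/-! ## §3 At a field point `x` of `Y′`: level sections and the exact twisted polarisation along the cover leg -/

section Point

variable {Y Y' : Scheme.{u}} (g : Y' ⟶ Y) {Ω : Type u} [Field Ω] (x : Spec (.of Ω) ⟶ Y') {A : AbelianSchemeOver Y} {O : Type*} [CommRing O]
  (act : A.RingAction O) [IsCommMonObj A.X] {m : ℕ} (E' : Matrix (Fin m) (Fin m) O) (hE' : E' * E' = E') (P : Matrix (Fin m) (Fin 1) O)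

/-- **(r5₀-c) THE COVER LEG CARRIES LEVEL SECTIONS**: for level structures `lvl` on `𝒜` and `lvl′` on `𝒞 = 𝒜 ⊗_𝒪 𝔟` with `lvl′.σ i = lvl.σ i ≫ ψ_P` (★
`LevelStructure.existsUnique_serreTwist`), the `Ω`-point `σ^a(x)` of the base-changed level structure of `𝒜` is carried by `c̄` to `σ_𝒞^a(x)`:
`c̄((lvl ×_Y Y′)(a)(x)) = (lvl′ ×_Y Y′)(a)(x)` — VERBATIM the `lvlPt₀Of`∕`lvlPtΩOf` currency `(𝒜.baseChange ι).restrictPt x ((lvl.baseChange ι).section_ a)`.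
[cite: MumfordFogartyKirwan1994, Ch. 7 §2 Definition 7.2 (p. 129)] [cite: RapoportSmithlingZhang2020Diagonal, §3.2 p. 11] -/
theorem map_coverLeg_restrictPt_section {g₀ n : ℕ} (lvl : A.LevelStructure g₀ n) (lvl' : (serreTensor act E' hE').LevelStructure g₀ n)
    (h : ∀ i, lvl'.σ i = lvl.σ i ≫ serreTranslate act E' hE' P) (a : Fin g₀ ⊕ Fin g₀ → ZMod n) :
    AlgPoints.map (baseChangeHom (baseChangeHom (serreTranslate act E' hE' P) g) x)
        ((A.baseChange g).restrictPt x ((lvl.baseChange g).section_ a)) =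
      ((serreTensor act E' hE').baseChange g).restrictPt x ((lvl'.baseChange g).section_ a) := by
  haveI := isMonHom_serreTranslate act E' hE' P
  haveI := isMonHom_baseChangeHom (serreTranslate act E' hE' P) g
  have hσ : ∀ i, (lvl'.baseChange g).σ i = (lvl.baseChange g).σ i ≫ baseChangeHom (serreTranslate act E' hE' P) g :=
    LevelStructure.baseChange_σ_serreTwist g act E' hE' P h
  rw [LevelStructure.section_of_σ_comp hσ a, ← map_fibreHom_restrictPt x (baseChangeHom (serreTranslate act E' hE' P) g)]
  rfl

/-- **(r3₀-c) THE COVER LEG PULLS THE EXACT TWISTED POLARISATION BACK TO `c • λ`**: if `λ′ : 𝒞 → 𝒞^` is `ψ_P`-exact with scalar `c` (★ `IsExactTwistPol`: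
`ψ_P ≫ λ′ ≫ ψ_P^∨ = λ ≫ [c]`), then at the iterated base change `c̄ ≫ λ′_{x} ≫ c̄^∨ = λ_{x} ≫ [c]` with the base-changed dual pairs — VERBATIM the `Roof₀` clause
`c ≫ lamB ≫ dualIsogenyOver c (dual₀Of … D x̄″) DB = (pol₀Of … pol x̄″).lam ≫ (dual₀Of … D x̄″).hat.mulN c` (★ `DualPair.baseChangeHom_similitude_base` twice).
[cite: MumfordFogartyKirwan1994, Ch. 6 §1 Cor. 6.8 (p. 118) and Ch. 7 §2 Definition 7.2 (p. 129)] [cite: RapoportSmithlingZhang2020Diagonal, §4.3 (4.23) (p. 21)] -/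
theorem coverLeg_comp_lam_comp_dualIsogenyOver_of_isExactTwistPol {Y'' : Scheme.{u}} (s : Y'' ⟶ Y')
    (D : A.DualPair) (Db : (serreTensor act E' hE').DualPair) (pol : A.Polarization D) {c : ℕ}
    {lam' : (serreTensor act E' hE').X ⟶ Db.hat.X} [IsMonHom lam'] (h : IsExactTwistPol act E' hE' P D Db pol c lam') :
    haveI := isMonHom_coverLeg g s act E' hE' P
    baseChangeHom (baseChangeHom (serreTranslate act E' hE' P) g) s ≫ baseChangeHom (baseChangeHom lam' g) s ≫
        DualPair.dualIsogenyOver (baseChangeHom (baseChangeHom (serreTranslate act E' hE' P) g) s)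
          ((D.baseChange g).baseChange s) ((Db.baseChange g).baseChange s) =
      ((pol.baseChange g).baseChange s).lam ≫ ((D.baseChange g).baseChange s).hat.mulN c := by
  haveI := isMonHom_serreTranslate act E' hE' P
  haveI := isMonHom_baseChangeHom (serreTranslate act E' hE' P) g
  have h1 := IsExactTwistPol.baseChange g act E' hE' P D Db pol h
  rw [Polarization.baseChange_lam] at h1
  have h2 := DualPair.baseChangeHom_similitude_base s (baseChangeHom (serreTranslate act E' hE' P) g) (D.baseChange g) (Db.baseChange g)
    (baseChangeHom pol.lam g) (baseChangeHom lam' g) c h1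
  rw [Polarization.baseChange_lam, Polarization.baseChange_lam]
  exact h2

end Point

/-! ## §4 The bridge to the Serre tensor OF the iterated base change: `c̄ ≫ β₂ = ψ_P(𝒜_{Y″})` -/

section Bridge

variable {Y Y' Y'' : Scheme.{u}} (g : Y' ⟶ Y) (s : Y'' ⟶ Y') {A : AbelianSchemeOver Y} {O : Type*} [CommRing O] (act : A.RingAction O)
  [IsCommMonObj A.X] {m : ℕ} (E' : Matrix (Fin m) (Fin m) O) (hE' : E' * E' = E') (P : Matrix (Fin m) (Fin 1) O)

/-- **THE BRIDGE `c̄ ≫ β₂ = ψ_P(𝒜_{Y″})`**: composed with the two-step base-change isomorphism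
`β₂ := (β(g) ×_{Y′} Y″) ≫ β(s) : ((𝒜 ⊗ 𝔟) ×_Y Y′) ×_{Y′} Y″ ≅ ((𝒜 ×_Y Y′) ×_{Y′} Y″) ⊗ 𝔟` (★ `serreTensorBaseChangeIso′` twice), the cover leg IS the ideal translation of
the iterated base change `𝒜_{Y″}` with its base-changed action — the currency in which ★ KER-EQ (`exists_iso_serreTranslate_comp_eq_of_comp_eq_one_iff_forall_mem`) and ★
σ2-GLUE (`FrobeniusTwistOfRoof`) read a roof leg. [cite: Conrad2004GrossZagier, §7 (Thm. 7.5)] [cite: GortzWedhorn2020, Section (4.7) (pp. 107–108)] -/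
theorem coverLeg_comp_baseChangeIso₂_hom (hP : E' * P = P) :
    baseChangeHom (baseChangeHom (serreTranslate act E' hE' P) g) s ≫
        (baseChangeHom (A := (serreTensor act E' hE').baseChange g) (B := serreTensorBC g act E' hE') (serreTensorBaseChangeIso' g act E' hE').hom s ≫
          (@serreTensorBaseChangeIso' Y' Y'' s (A.baseChange g) O _ (act.baseChange g) (isCommMonObj_baseChange g) m E' hE').hom) =
      @serreTranslate Y'' ((A.baseChange g).baseChange s) O _ ((act.baseChange g).baseChange s)
        (@isCommMonObj_baseChange Y' Y'' s (A.baseChange g) (isCommMonObj_baseChange g)) m E' hE' P := by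
  haveI := isCommMonObj_baseChange g (A := A)
  have h1 : baseChangeHom (baseChangeHom (serreTranslate act E' hE' P) g) s ≫
      baseChangeHom (A := (serreTensor act E' hE').baseChange g) (B := serreTensorBC g act E' hE') (serreTensorBaseChangeIso' g act E' hE').hom s =
      baseChangeHom (@serreTranslate Y' (A.baseChange g) O _ (act.baseChange g) (isCommMonObj_baseChange g) m E' hE' P) s := by
    change (Over.pullback s).map _ ≫ (Over.pullback s).map _ = (Over.pullback s).map _
    rw [← Functor.map_comp]
    exact congrArg _ (serreTranslateBC_comp_baseChangeIso g act P E' hE' hP)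
  rw [← Category.assoc, h1]
  exact @serreTranslateBC_comp_baseChangeIso Y' Y'' s (A.baseChange g) O _ (act.baseChange g) m P (isCommMonObj_baseChange g) E' hE' hP

/-- Both maps of the two-step bridge are homomorphisms (★ `isMonHom_serreTensorBaseChangeIso`, base-changed). [cite: Conrad2004GrossZagier, §7 (Thm. 7.5)] -/
theorem isMonHom_baseChangeIso₂ :
    IsMonHom (baseChangeHom (A := (serreTensor act E' hE').baseChange g) (B := serreTensorBC g act E' hE') (serreTensorBaseChangeIso' g act E' hE').hom s ≫
        (@serreTensorBaseChangeIso' Y' Y'' s (A.baseChange g) O _ (act.baseChange g) (isCommMonObj_baseChange g) m E' hE').hom) ∧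
      IsMonHom ((@serreTensorBaseChangeIso' Y' Y'' s (A.baseChange g) O _ (act.baseChange g) (isCommMonObj_baseChange g) m E' hE').inv ≫
        baseChangeHom (A := serreTensorBC g act E' hE') (B := (serreTensor act E' hE').baseChange g) (serreTensorBaseChangeIso' g act E' hE').inv s) := by
  haveI := isCommMonObj_baseChange g (A := A)
  haveI : IsMonHom (serreTensorBaseChangeIso' g act E' hE').hom := (isMonHom_serreTensorBaseChangeIso g act E' hE').1
  haveI : IsMonHom (serreTensorBaseChangeIso' g act E' hE').inv := (isMonHom_serreTensorBaseChangeIso g act E' hE').2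
  haveI : IsMonHom (@serreTensorBaseChangeIso' Y' Y'' s (A.baseChange g) O _ (act.baseChange g) (isCommMonObj_baseChange g) m E' hE').hom :=
    (@isMonHom_serreTensorBaseChangeIso Y' Y'' s (A.baseChange g) O _ (act.baseChange g) (isCommMonObj_baseChange g) m E' hE').1
  haveI : IsMonHom (@serreTensorBaseChangeIso' Y' Y'' s (A.baseChange g) O _ (act.baseChange g) (isCommMonObj_baseChange g) m E' hE').inv :=
    (@isMonHom_serreTensorBaseChangeIso Y' Y'' s (A.baseChange g) O _ (act.baseChange g) (isCommMonObj_baseChange g) m E' hE').2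
  haveI : IsMonHom (baseChangeHom (A := (serreTensor act E' hE').baseChange g) (B := serreTensorBC g act E' hE')
      (serreTensorBaseChangeIso' g act E' hE').hom s) := isMonHom_baseChangeHom _ s
  haveI : IsMonHom (baseChangeHom (A := serreTensorBC g act E' hE') (B := (serreTensor act E' hE').baseChange g)
      (serreTensorBaseChangeIso' g act E' hE').inv s) := isMonHom_baseChangeHom _ s
  exact ⟨inferInstance, inferInstance⟩

end Bridge

end AbelianSchemeOver

end Literature.AlgebraicGeometry.AbelianSchemes

end
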